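import Summits.Ventures.LatticeQCDFlow.Scoring.WilsonFlowRK3Rate
import Literature.MathematicalPhysics.QuantumLattice.CloverObservables
import HarnessLib

/-!
# Lipschitz observables inherit the integrator's rate: the measured flowed clover charge and clover energy are within `O(1/m)` of the exactly flowed ones, uniformly, and so are their means

HONEST FRAMING: exact (Metropolis-corrected) sampling algorithms for lattice gauge theory;
figures of merit are autocorrelation/cost numbers at stated couplings and volumes; no
continuum-physics claim.

Venture `LatticeQCDFlow` (cell pub-lqcd), sub-topic `Scoring`; FANOUT row 16 (`su2-base`: `τ_int` of the clover
charge `Q` and of `t²E`, both measured on the RK3-flowed field).  Fifth file of the RK3-CONVERGENCE packet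
(`WilsonFlowRK3Rate.dist_iterate_wilsonFlowRK3_le_div`: `dist (RK3_{t/m}^m V) (wilsonFlow t V) ≤ C/m` uniformly;
`WilsonFlowRK3Convergence.dist_coeConfig`).  NEW WORK of the cell (placement rule) over the Literature's clover
observables (`QuantumLattice/CloverPseudoscalar`, `CloverObservables`: `cloverLeafSum` — Lüscher's four-leaf sum,
a polynomial in the link matrices and their conjugate transposes —, `lieProjection` — the orthogonal projection
onto the Lie algebra, a continuous linear map —, `flowedClover_zero`, `cloverPseudoscalar`, `flowedCloverEnergy`)
and the Wilson-flow ambient calculus (`QuantumFieldTheory/WilsonFlow`: `contDiff_eval`,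
`contDiff_eval_conjTranspose`, `contDiff_trace`, `coeConfig_mem_closedBall`, `ρ₀`).  Nothing is cited as a fact;
no number (constants existential).  Printed counterpart, NAMED ONLY: Lüscher, JHEP 08 (2010) 071, §3.2 / App. C.

## What is here

* §1 (every `d`, `n`, `L ≥ 1`) **`exists_lipschitzWith_comp_coeConfig`** — an observable that is the restriction to
  `SU(n)^E` of a `C¹` function of the ambient matrix configuration is LIPSCHITZ for the configuration metric
  (mean value on the compact convex ball `closedBall 0 ρ₀ ⊇ SU(n)^E`, and `coeConfig` is an isometry);
  **`dist_comp_iterate_wilsonFlowRK3_le_div`** — a `K`-Lipschitz observable of the RK3-flowed field is within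
  `C/m` of the same observable of the exactly flowed field, for all `m ≥ t` and ALL configurations;
  **`abs_integral_comp_iterate_wilsonFlowRK3_sub_le`** — and so is its MEAN under any finite measure
  (`≤ C · μ(univ) / m`).
* §2 (`d = 4`, `SU(n)` fundamental) the clover observables ARE such restrictions: `cloverAmb x μ ν` (the ambient
  bare clover `π_𝔤(¼ Q_{μν}(x))`, `C^m` by `contDiff_cloverLeafSum` + linearity of `π_𝔤`),
  `cloverPseudoscalarAmb x`, `cloverEnergyAmb x` with `contDiff_cloverPseudoscalarAmb`, `contDiff_cloverEnergyAmb`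
  and the dictionaries `cloverPseudoscalar_eq_amb`, `flowedCloverEnergy_eq_amb`; hence
  `exists_lipschitzWith_cloverCharge`, `exists_lipschitzWith_cloverEnergy`.
* §3 **`abs_rk3CloverCharge_sub_le_div`**, **`abs_integral_rk3CloverCharge_sub_le_div`**,
  `abs_rk3CloverEnergy_sub_le_div`, `abs_integral_rk3CloverEnergy_sub_le_div` — for every `t ≥ 0` there is `C`
  with `|Σ_x P_x(RK3_{t/m}^m U) − Σ_x P_x(wilsonFlow t U)| ≤ C/m` for all `m ≥ t` and all `U`, the same for `E_x`, and
  the same for their means under any finite measure on configurations (times `μ(univ)`).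

NOT CLAIMED: the constants (existential, from compactness at fixed `d`, `L`, `n` — no uniformity in the volume is
claimed); order three; anything about `τ_int` (a functional of the chain, not of one
configuration); any number.
-/

namespace Summit.Ventures.LatticeQCDFlow.Scoring

open Matrix Filter Topology Set MeasureTheory Literature.MathematicalPhysics.QuantumFieldTheory
open Literature.MathematicalPhysics.QuantumFieldTheory.Luscher2010 (AmbConfig)
open Summit.Ventures.LatticeQCDFlow.Theory2.Lattice.SUN (dist_coeConfig)
open Literature.MathematicalPhysics.QuantumLattice (fundamentalRep cloverLeafSum lieProjection flowedClover
  flowedClover_zero cloverPseudoscalar flowedCloverEnergy)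

open scoped Matrix.Norms.Frobenius NNReal

-- The scoped Frobenius instances are definitionally the product structures, but only at default transparency
-- (as in Mathlib's `MatrixExponential` and `Scoring/WilsonFlowRK3Consistency`).
set_option backward.isDefEq.respectTransparency false

/-! ## §1 Lipschitz observables and the inherited rate -/

section Lipschitz

variable {d L n : ℕ} [NeZero L]

/-- **Restrictions of ambient `C¹` functions are Lipschitz observables.**  If `f` is `C¹` on the ambient matrix
configuration space, then `U ↦ f (coeConfig U)` is Lipschitz on `SU(n)^E` for the configuration metric (the
derivative is bounded on the compact convex ball `closedBall 0 ρ₀`, which contains every configuration, and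
`coeConfig` is an isometry). -/
theorem exists_lipschitzWith_comp_coeConfig {F : Type*} [NormedAddCommGroup F] [NormedSpace ℝ F]
    {f : AmbConfig d L n → F} (hf : ContDiff ℝ 1 f) :
    ∃ K : ℝ≥0, LipschitzWith K fun U : GaugeConfig d L (Matrix.specialUnitaryGroup (Fin n) ℂ) =>
      f (WilsonFlow.coeConfig U) := by
  obtain ⟨K, hK⟩ := hf.contDiffOn.exists_lipschitzOnWith one_ne_zero
    (convex_closedBall (0 : AmbConfig d L n) (WilsonFlow.ρ₀ d L n)) (isCompact_closedBall _ _)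
  refine ⟨K, LipschitzWith.of_dist_le_mul fun U U' => ?_⟩
  rw [← dist_coeConfig]
  exact hK.dist_le_mul _ (WilsonFlow.coeConfig_mem_closedBall U) _ (WilsonFlow.coeConfig_mem_closedBall U')

/-- **A Lipschitz observable of the RK3-flowed field is within `O(1/m)` of the same observable of the exactly
flowed field, uniformly in the configuration**: for every `t ≥ 0` there is `C` with
`dist (F (RK3_{t/m}^m V)) (F (wilsonFlow t V)) ≤ C/m` for all `m ≥ t` and all `V`. -/
theorem dist_comp_iterate_wilsonFlowRK3_le_div {Y : Type*} [PseudoMetricSpace Y]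
    {F : GaugeConfig d L (Matrix.specialUnitaryGroup (Fin n) ℂ) → Y} {K : ℝ≥0} (hF : LipschitzWith K F)
    {t : ℝ} (ht : 0 ≤ t) :
    ∃ C : ℝ, 0 ≤ C ∧ ∀ m : ℕ, t ≤ m → ∀ V : GaugeConfig d L (Matrix.specialUnitaryGroup (Fin n) ℂ),
      dist (F ((wilsonFlowRK3 (t / m))^[m] V)) (F (wilsonFlow t V)) ≤ C / m := by
  obtain ⟨C, hC0, hC⟩ := dist_iterate_wilsonFlowRK3_le_div (d := d) (L := L) (n := n) ht
  refine ⟨K * C, mul_nonneg K.coe_nonneg hC0, fun m hm V => ?_⟩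
  calc dist (F ((wilsonFlowRK3 (t / m))^[m] V)) (F (wilsonFlow t V))
        ≤ K * dist ((wilsonFlowRK3 (t / m))^[m] V) (wilsonFlow t V) := hF.dist_le_mul _ _
    _ ≤ K * (C / m) := mul_le_mul_of_nonneg_left (hC m hm V) K.coe_nonneg
    _ = K * C / m := by ring

/-- A continuous real observable on the (compact) configuration space is integrable for every finite measure. -/
theorem integrable_of_continuous_config {F : GaugeConfig d L (Matrix.specialUnitaryGroup (Fin n) ℂ) → ℝ}
    (hF : Continuous F) (μ : Measure (GaugeConfig d L (Matrix.specialUnitaryGroup (Fin n) ℂ)))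
    [IsFiniteMeasure μ] : Integrable F μ := by
  obtain ⟨C, hC⟩ := (isCompact_range hF).isBounded.subset_closedBall (0 : ℝ)
  have hbound : ∀ U, ‖F U‖ ≤ C := fun U => by
    have h := hC (mem_range_self U)
    rwa [Metric.mem_closedBall, dist_zero_right] at h
  exact Integrable.mono' (integrable_const C) hF.measurable.aestronglyMeasurable (Eventually.of_forall hbound)

/-- **Means of Lipschitz observables inherit the rate**: for every finite measure `μ` on configurations and every
`t ≥ 0` there is `C` with `|∫ F(RK3_{t/m}^m U) dμ − ∫ F(wilsonFlow t U) dμ| ≤ C · μ(univ) / m` for all `m ≥ t`. -/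
theorem abs_integral_comp_iterate_wilsonFlowRK3_sub_le
    {F : GaugeConfig d L (Matrix.specialUnitaryGroup (Fin n) ℂ) → ℝ} {K : ℝ≥0} (hF : LipschitzWith K F)
    (μ : Measure (GaugeConfig d L (Matrix.specialUnitaryGroup (Fin n) ℂ))) [IsFiniteMeasure μ] {t : ℝ} (ht : 0 ≤ t) :
    ∃ C : ℝ, 0 ≤ C ∧ ∀ m : ℕ, t ≤ m →
      |(∫ U, F ((wilsonFlowRK3 (t / m))^[m] U) ∂μ) - ∫ U, F (wilsonFlow t U) ∂μ| ≤ C * μ.real univ / m := by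
  obtain ⟨C, hC0, hC⟩ := dist_comp_iterate_wilsonFlowRK3_le_div hF ht
  refine ⟨C, hC0, fun m hm => ?_⟩
  have hi1 : Integrable (fun U => F ((wilsonFlowRK3 (t / m))^[m] U)) μ :=
    integrable_of_continuous_config (hF.continuous.comp (continuous_iterate_wilsonFlowRK3 _ m)) μ
  have hi2 : Integrable (fun U => F (wilsonFlow t U)) μ :=
    integrable_of_continuous_config (hF.continuous.comp (continuous_wilsonFlow t)) μ
  rw [← integral_sub hi1 hi2]
  have hb : ∀ᵐ U ∂μ, ‖F ((wilsonFlowRK3 (t / m))^[m] U) - F (wilsonFlow t U)‖ ≤ C / m :=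
    Eventually.of_forall fun U => by
      rw [Real.norm_eq_abs, ← Real.dist_eq]
      exact hC m hm U
  have h := norm_integral_le_of_norm_le_const hb
  rw [Real.norm_eq_abs] at h
  calc |∫ U, (F ((wilsonFlowRK3 (t / m))^[m] U) - F (wilsonFlow t U)) ∂μ| ≤ C / m * μ.real univ := h
    _ = C * μ.real univ / m := by ring

end Lipschitz

/-! ## §2 The clover observables are restrictions of smooth ambient functions -/

section Clover

variable {L n : ℕ} [NeZero L]

/-- Lüscher's four-leaf sum `Q_{μν}(x)` is a `C^m` (polynomial) function of the ambient configuration. -/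
theorem contDiff_cloverLeafSum {m : WithTop ℕ∞} (x : Site 4 L) (μ ν : Fin 4) :
    ContDiff ℝ m fun W : AmbConfig 4 L n => cloverLeafSum W x μ ν := by
  unfold cloverLeafSum
  have hE := fun e : Edge 4 L => WilsonFlow.contDiff_eval (d := 4) (L := L) (n := n) (m := m) e
  have hC := fun e : Edge 4 L => WilsonFlow.contDiff_eval_conjTranspose (d := 4) (L := L) (n := n) (m := m) e
  exact ((((((hE _).mul (hE _)).mul (hC _)).mul (hC _)).add
    ((((hE _).mul (hC _)).mul (hC _)).mul (hE _))).add
    ((((hC _).mul (hC _)).mul (hE _)).mul (hE _))).add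
    ((((hC _).mul (hE _)).mul (hE _)).mul (hC _))

/-- **The ambient bare clover** `π_𝔤(¼ Q_{μν}(x))(W)` of a matrix configuration (for the Lie algebra of `SU(n)` in
the fundamental representation): on `SU(n)` configurations it is the Literature's `flowedClover ρ 0`
(`flowedClover_eq_cloverAmb`). -/
noncomputable def cloverAmb (x : Site 4 L) (μ ν : Fin 4) (W : AmbConfig 4 L n) : Matrix (Fin n) (Fin n) ℂ :=
  lieProjection (Set.range (fundamentalRep (Fin n))) ((1 / 4 : ℝ) • cloverLeafSum W x μ ν)

omit [NeZero L] in
/-- Dictionary: the bare clover of an `SU(n)` configuration is the ambient clover of its image. -/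
theorem flowedClover_eq_cloverAmb (U : GaugeConfig 4 L (Matrix.specialUnitaryGroup (Fin n) ℂ)) (x : Site 4 L)
    (μ ν : Fin 4) : flowedClover (fundamentalRep (Fin n)) 0 U x μ ν = cloverAmb x μ ν (WilsonFlow.coeConfig U) := by
  rw [flowedClover_zero, cloverAmb]
  rfl

/-- The ambient clover is `C^m` (a continuous linear projection of a polynomial). -/
theorem contDiff_cloverAmb {m : WithTop ℕ∞} (x : Site 4 L) (μ ν : Fin 4) :
    ContDiff ℝ m fun W : AmbConfig 4 L n => cloverAmb x μ ν W :=
  (lieProjection (Set.range (fundamentalRep (Fin n)))).contDiff.comp ((contDiff_cloverLeafSum x μ ν).const_smul _)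

/-- **The ambient clover pseudoscalar density** `−2 Re tr(C₀₁C₂₃ − C₀₂C₁₃ + C₀₃C₁₂)` built from `cloverAmb`. -/
noncomputable def cloverPseudoscalarAmb (x : Site 4 L) (W : AmbConfig 4 L n) : ℝ :=
  -2 * (cloverAmb x 0 1 W * cloverAmb x 2 3 W - cloverAmb x 0 2 W * cloverAmb x 1 3 W +
    cloverAmb x 0 3 W * cloverAmb x 1 2 W).trace.re

omit [NeZero L] in
/-- Dictionary: `P_x(U) = cloverPseudoscalarAmb x (coeConfig U)`. -/
theorem cloverPseudoscalar_eq_amb (x : Site 4 L) (U : GaugeConfig 4 L (Matrix.specialUnitaryGroup (Fin n) ℂ)) :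
    cloverPseudoscalar (fundamentalRep (Fin n)) x U = cloverPseudoscalarAmb x (WilsonFlow.coeConfig U) := by
  simp only [cloverPseudoscalar, cloverPseudoscalarAmb, flowedClover_eq_cloverAmb]

/-- The ambient clover pseudoscalar density is `C^m`. -/
theorem contDiff_cloverPseudoscalarAmb {m : WithTop ℕ∞} (x : Site 4 L) :
    ContDiff ℝ m (cloverPseudoscalarAmb (L := L) (n := n) x) := by
  have h := fun μ ν => contDiff_cloverAmb (L := L) (n := n) (m := m) x μ ν
  have hM : ContDiff ℝ m fun W : AmbConfig 4 L n =>
      cloverAmb x 0 1 W * cloverAmb x 2 3 W - cloverAmb x 0 2 W * cloverAmb x 1 3 W +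
        cloverAmb x 0 3 W * cloverAmb x 1 2 W :=
    (((h 0 1).mul (h 2 3)).sub ((h 0 2).mul (h 1 3))).add ((h 0 3).mul (h 1 2))
  unfold cloverPseudoscalarAmb
  exact contDiff_const.mul (Complex.reCLM.contDiff.comp (WilsonFlow.contDiff_trace.comp hM))

/-- **The ambient clover energy density** `Σ_{μ<ν} Re tr(C_{μν}ᴴ C_{μν})` built from `cloverAmb`. -/
noncomputable def cloverEnergyAmb (x : Site 4 L) (W : AmbConfig 4 L n) : ℝ :=
  ∑ μ : Fin 4, ∑ ν : Fin 4, if μ < ν then ((cloverAmb x μ ν W)ᴴ * cloverAmb x μ ν W).trace.re else 0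

omit [NeZero L] in
/-- Dictionary: `E_x(U) = cloverEnergyAmb x (coeConfig U)` (bare clover energy, flow time `0`). -/
theorem flowedCloverEnergy_eq_amb (x : Site 4 L) (U : GaugeConfig 4 L (Matrix.specialUnitaryGroup (Fin n) ℂ)) :
    flowedCloverEnergy (fundamentalRep (Fin n)) 0 x U = cloverEnergyAmb x (WilsonFlow.coeConfig U) := by
  simp only [flowedCloverEnergy, cloverEnergyAmb, flowedClover_eq_cloverAmb]

/-- The ambient clover energy density is `C^m`. -/
theorem contDiff_cloverEnergyAmb {m : WithTop ℕ∞} (x : Site 4 L) :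
    ContDiff ℝ m (cloverEnergyAmb (L := L) (n := n) x) := by
  have h := fun μ ν => contDiff_cloverAmb (L := L) (n := n) (m := m) x μ ν
  unfold cloverEnergyAmb
  refine ContDiff.sum fun μ _ => ContDiff.sum fun ν _ => ?_
  by_cases hμν : μ < ν
  · simp only [hμν, if_true]
    exact Complex.reCLM.contDiff.comp (WilsonFlow.contDiff_trace.comp
      ((WilsonFlow.contDiff_conjTranspose.comp (h μ ν)).mul (h μ ν)))
  · simp only [hμν, if_false]
    exact contDiff_const

/-- **The total clover charge is a Lipschitz observable** of the `SU(n)` configuration (configuration metric). -/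
theorem exists_lipschitzWith_cloverCharge :
    ∃ K : ℝ≥0, LipschitzWith K fun U : GaugeConfig 4 L (Matrix.specialUnitaryGroup (Fin n) ℂ) =>
      ∑ x : Site 4 L, cloverPseudoscalar (fundamentalRep (Fin n)) x U := by
  have hf : ContDiff ℝ 1 fun W : AmbConfig 4 L n => ∑ x : Site 4 L, cloverPseudoscalarAmb x W :=
    ContDiff.sum fun x _ => contDiff_cloverPseudoscalarAmb x
  obtain ⟨K, hK⟩ := exists_lipschitzWith_comp_coeConfig hf
  refine ⟨K, ?_⟩
  have hfun : (fun U : GaugeConfig 4 L (Matrix.specialUnitaryGroup (Fin n) ℂ) =>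
      ∑ x : Site 4 L, cloverPseudoscalar (fundamentalRep (Fin n)) x U) =
      fun U => ∑ x : Site 4 L, cloverPseudoscalarAmb x (WilsonFlow.coeConfig U) := by
    funext U
    simp only [cloverPseudoscalar_eq_amb]
  rw [hfun]
  exact hK

/-- **The clover energy at a site is a Lipschitz observable** of the `SU(n)` configuration. -/
theorem exists_lipschitzWith_cloverEnergy (x : Site 4 L) :
    ∃ K : ℝ≥0, LipschitzWith K fun U : GaugeConfig 4 L (Matrix.specialUnitaryGroup (Fin n) ℂ) =>
      flowedCloverEnergy (fundamentalRep (Fin n)) 0 x U := by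
  obtain ⟨K, hK⟩ := exists_lipschitzWith_comp_coeConfig (contDiff_cloverEnergyAmb (m := 1) x)
  refine ⟨K, ?_⟩
  have hfun : (fun U : GaugeConfig 4 L (Matrix.specialUnitaryGroup (Fin n) ℂ) =>
      flowedCloverEnergy (fundamentalRep (Fin n)) 0 x U) = fun U => cloverEnergyAmb x (WilsonFlow.coeConfig U) := by
    funext U
    exact flowedCloverEnergy_eq_amb x U
  rw [hfun]
  exact hK

end Clover

/-! ## §3 Rates for the recorded observables -/

section Rates

variable {L n : ℕ} [NeZero L]

/-- **The measured flowed clover charge is within `O(1/m)` of the exactly flowed one, uniformly**: for every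
`t ≥ 0` there is `C` such that for all `m ≥ t` and EVERY configuration `U` on `(ℤ/L)^4`,
`|Σ_x P_x(RK3_{t/m}^m U) − Σ_x P_x(wilsonFlow t U)| ≤ C / m`. -/
theorem abs_rk3CloverCharge_sub_le_div {t : ℝ} (ht : 0 ≤ t) :
    ∃ C : ℝ, 0 ≤ C ∧ ∀ m : ℕ, t ≤ m → ∀ U : GaugeConfig 4 L (Matrix.specialUnitaryGroup (Fin n) ℂ),
      |(∑ x : Site 4 L, cloverPseudoscalar (fundamentalRep (Fin n)) x ((wilsonFlowRK3 (t / m))^[m] U)) -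
        ∑ x : Site 4 L, cloverPseudoscalar (fundamentalRep (Fin n)) x (wilsonFlow t U)| ≤ C / m := by
  obtain ⟨K, hK⟩ := exists_lipschitzWith_cloverCharge (L := L) (n := n)
  obtain ⟨C, hC0, hC⟩ := dist_comp_iterate_wilsonFlowRK3_le_div hK ht
  exact ⟨C, hC0, fun m hm U => by rw [← Real.dist_eq]; exact hC m hm U⟩

/-- **Its mean under any finite measure is within `O(1/m)`** (times `μ(univ)`): every `t ≥ 0`, all `m ≥ t`. -/
theorem abs_integral_rk3CloverCharge_sub_le_div
    (μ : Measure (GaugeConfig 4 L (Matrix.specialUnitaryGroup (Fin n) ℂ))) [IsFiniteMeasure μ] {t : ℝ} (ht : 0 ≤ t) :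
    ∃ C : ℝ, 0 ≤ C ∧ ∀ m : ℕ, t ≤ m →
      |(∫ U, (∑ x : Site 4 L, cloverPseudoscalar (fundamentalRep (Fin n)) x ((wilsonFlowRK3 (t / m))^[m] U)) ∂μ) -
        ∫ U, (∑ x : Site 4 L, cloverPseudoscalar (fundamentalRep (Fin n)) x (wilsonFlow t U)) ∂μ| ≤
        C * μ.real univ / m := by
  obtain ⟨K, hK⟩ := exists_lipschitzWith_cloverCharge (L := L) (n := n)
  exact abs_integral_comp_iterate_wilsonFlowRK3_sub_le hK μ ht

/-- **The measured flowed clover energy at a site is within `O(1/m)` of the exactly flowed one, uniformly**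
(row 16's `t²E`, up to the factor `t²`). -/
theorem abs_rk3CloverEnergy_sub_le_div {t : ℝ} (ht : 0 ≤ t) (x : Site 4 L) :
    ∃ C : ℝ, 0 ≤ C ∧ ∀ m : ℕ, t ≤ m → ∀ U : GaugeConfig 4 L (Matrix.specialUnitaryGroup (Fin n) ℂ),
      |flowedCloverEnergy (fundamentalRep (Fin n)) 0 x ((wilsonFlowRK3 (t / m))^[m] U) -
        flowedCloverEnergy (fundamentalRep (Fin n)) 0 x (wilsonFlow t U)| ≤ C / m := by
  obtain ⟨K, hK⟩ := exists_lipschitzWith_cloverEnergy (L := L) (n := n) x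
  obtain ⟨C, hC0, hC⟩ := dist_comp_iterate_wilsonFlowRK3_le_div hK ht
  exact ⟨C, hC0, fun m hm U => by rw [← Real.dist_eq]; exact hC m hm U⟩

/-- Its mean under any finite measure is within `O(1/m)` (times `μ(univ)`). -/
theorem abs_integral_rk3CloverEnergy_sub_le_div
    (μ : Measure (GaugeConfig 4 L (Matrix.specialUnitaryGroup (Fin n) ℂ))) [IsFiniteMeasure μ] {t : ℝ} (ht : 0 ≤ t)
    (x : Site 4 L) :
    ∃ C : ℝ, 0 ≤ C ∧ ∀ m : ℕ, t ≤ m →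
      |(∫ U, flowedCloverEnergy (fundamentalRep (Fin n)) 0 x ((wilsonFlowRK3 (t / m))^[m] U) ∂μ) -
        ∫ U, flowedCloverEnergy (fundamentalRep (Fin n)) 0 x (wilsonFlow t U) ∂μ| ≤ C * μ.real univ / m := by
  obtain ⟨K, hK⟩ := exists_lipschitzWith_cloverEnergy (L := L) (n := n) x
  exact abs_integral_comp_iterate_wilsonFlowRK3_sub_le hK μ ht

end Rates

end Summit.Ventures.LatticeQCDFlow.Scoring
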